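import Summits.QuantumFields.YangMills.Theorems.SwapVirialDeficitBlowUpGnomonicCartHubDefs
import Summits.QuantumFields.YangMills.Theorems.SwapVirialDeficitGnomonicDeficitSmooth
import Summits.QuantumFields.YangMills.Theorems.SwapVirialDeficitBlowUpLetterPaths
import Summits.QuantumFields.YangMills.Theorems.SwapVirialDeficitBlowUpGnomonicHubShiftSmooth
import HarnessLib

/-!
# Route `SwapVirialDeficit` (YangMills): THE FIXED-FRAME DEFICIT IS SMOOTH ACROSS THE APEX — `(h, η) ↦ F̂cart_{1 + h, ε}(η)` is `C^n` on `ℝ³ × GnoCoord L`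
# (brick P1b(iii) of w2 g60's memo2 = plan of record for `stub_core_tip` of skeleton ➎; free-hands support of ⟨stmt-QuantumFields-24197⟩ `SwapVirialDeficit.SwapGluedStiffness`)

In the Cartesian hub letters `a = r(1 + h)`, `h ∈ ℝ³` (✓`lintegral_coneMeasure_hubCart`), the hub `1 + h = ⟨1, h₀, h₁, h₂⟩` never vanishes, and the fixed-frame tuple
✓`leaderTupleCart` is built from `radialUnit (1 + h)` (smooth, ✓`contDiffAt_radialUnit` off `0`) and the gnomonic letters — so the σ-glued deficit
★★ `contDiff_gnoDeficitCart_hubCart` : `ContDiff ℝ n (fun q : (Fin 3 → ℝ) × GnoCoord L => gnoDeficitCart z χ (cartHub q.1) ε q.2)`, `cartHub h := ⟨1, h 0, h 1, h 2⟩`,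
is JOINTLY smooth in the hub letters and the fibre letters THROUGH the apex `h = 0` (✓`contDiff_chartDeficit_of_letters`).  This is the smoothness the polar chart lacks
(`radialUnit (axisPoint a)` is singular on `im a = 0`), and the input of the two-sided fibred Laplace step across `ψ = 0` (memo2 P2–P8).

HONEST LABEL: calculus plumbing; `stub_core_tip` and the other stubs, ⟨24197⟩ ∕ ⟨24194⟩ OPEN; own crux ⟨22884⟩ `LargeFieldMassRefinementTail` OPEN (blocked-on ⟨19935⟩); the
Yang–Mills mass gap is NOT proved; no summit is proved by a line.  THEOREMS ONLY (0 `def`, 0 `sorry`), standard axioms; the route's local `ℍ` measurability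
instances (for `quatReImEquiv`).  Width seat ym-line-sfw-p2-w2 g60 (cell ym-idea-1, free hands), `--supports stmt-QuantumFields-24197`.  References: [cite: Luscher1983, §2]; [folklore].
-/

set_option autoImplicit false

noncomputable section

open Quaternion Set
open scoped Quaternion
open Literature.MathematicalPhysics.QuantumLattice
open Literature.MathematicalPhysics.QuantumFieldTheory hiding SU2

attribute [local instance] Literature.Analysis.FluidPDE.Tao2016.quatMeasurableSpace
  Literature.Analysis.FluidPDE.Tao2016.quatBorelSpace

namespace Summit.QuantumFields.YangMills.Theorems.SwapVirialDeficit.BlowUpRing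

open Summit.QuantumFields.YangMills.Theorems.FemtoTransferGap
open Summit.QuantumFields.YangMills.Theorems.FemtoTransferGap.TT
open Summit.QuantumFields.YangMills.Theorems.VirialFluxGap.RingDeficit
open Summit.QuantumFields.YangMills.Theorems.SwapVirialDeficit.SwapRing
open Summit.QuantumFields.YangMills.Theorems.SwapVirialDeficit.Gnomonic
open Literature.Analysis.Calculus (radialUnit radialUnit_def norm_radialUnit)
open Summit.QuantumFields.YangMills.Theorems.SwapVirialDeficit.ZeroModeSigma (slaveP slaveP_def su2Quat_quatToSU2_eq_radialUnit)
open Summit.QuantumFields.YangMills.Theorems.SwapVirialDeficit.BlowUp (contDiffAt_radialUnit)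

variable {L : ℕ} [NeZero L] {n : ℕ∞}

/-- The hub `1 + h = ⟨1, h₀, h₁, h₂⟩` of the Cartesian letters never vanishes. [folklore] -/
theorem quatReImEquiv_symm_one_ne_zero (h : Fin 3 → ℝ) : quatReImEquiv.symm (1, h) ≠ 0 := by
  intro h0
  have := congrArg (fun q : ℍ => q.re) h0
  rw [quatReImEquiv_symm_apply] at this
  simp at this

/-- `h ↦ ⟨1, h₀, h₁, h₂⟩ is smooth (affine: `1 + h₀·i + h₁·j + h₂·k`). [folklore] -/
theorem contDiff_quatReImEquiv_symm_one : ContDiff ℝ n fun h : Fin 3 → ℝ => (quatReImEquiv.symm (1, h) : ℍ) := by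
  set qI : ℍ := (⟨0, 1, 0, 0⟩ : ℍ) with hqI
  set qJ : ℍ := (⟨0, 0, 1, 0⟩ : ℍ) with hqJ
  set qK : ℍ := (⟨0, 0, 0, 1⟩ : ℍ) with hqK
  have e : (fun h : Fin 3 → ℝ => (quatReImEquiv.symm (1, h) : ℍ)) = fun h => (1 : ℍ) + h 0 • qI + h 1 • qJ + h 2 • qK := by
    funext h
    rw [quatReImEquiv_symm_apply, hqI, hqJ, hqK]
    ext <;> simp
  rw [e]
  exact ((contDiff_const.add ((contDiff_apply ℝ ℝ 0).smul contDiff_const)).add ((contDiff_apply ℝ ℝ 1).smul contDiff_const)).add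
    ((contDiff_apply ℝ ℝ 2).smul contDiff_const)

/-- `star ⟨1, h⟩ = ⟨1, −h⟩`. [folklore] -/
theorem star_quatReImEquiv_symm_one (h : Fin 3 → ℝ) : star (quatReImEquiv.symm (1, h) : ℍ) = quatReImEquiv.symm (1, -h) := by
  rw [quatReImEquiv_symm_apply, quatReImEquiv_symm_apply]
  ext <;> simp

/-- `h ↦ radialUnit ⟨1, h⟩` is smooth on all of `ℝ³` (✓`contDiffAt_radialUnit` off `0`). [folklore] -/
theorem contDiff_radialUnit_hubCart : ContDiff ℝ n fun h : Fin 3 → ℝ => radialUnit (quatReImEquiv.symm (1, h) : ℍ) :=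
  contDiff_iff_contDiffAt.2 fun h => (contDiffAt_radialUnit (quatReImEquiv_symm_one_ne_zero h)).comp h contDiff_quatReImEquiv_symm_one.contDiffAt

/-- ★★ **THE FIXED-FRAME DEFICIT IS JOINTLY SMOOTH IN THE CARTESIAN HUB LETTERS AND THE FIBRE LETTERS, THROUGH THE APEX**:
`(h, η) ↦ F̂cart_{z, 1+h, ε}(η)` is `C^n` on `ℝ³ × GnoCoord L`. [cite: Luscher1983, §2] -/
theorem contDiff_gnoDeficitCart_hubCart (z : Fin 3 → Bool) (χ : Site 3 L → SU2) (ε : GnoSign L) :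
    ContDiff ℝ n fun q : (Fin 3 → ℝ) × GnoCoord L => gnoDeficitCart z χ (quatReImEquiv.symm (1, q.1)) ε q.2 := by
  -- the smooth ingredients
  have hA : ContDiff ℝ n fun q : (Fin 3 → ℝ) × GnoCoord L => radialUnit (quatReImEquiv.symm (1, q.1) : ℍ) := contDiff_radialUnit_hubCart.comp contDiff_fst
  have hπx : ContDiff ℝ n fun q : (Fin 3 → ℝ) × GnoCoord L => q.2.1.1 := contDiff_fst.comp (contDiff_fst.comp contDiff_snd)
  have hπy : ContDiff ℝ n fun q : (Fin 3 → ℝ) × GnoCoord L => q.2.1.2 := contDiff_snd.comp (contDiff_fst.comp contDiff_snd)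
  have hπz : ContDiff ℝ n fun q : (Fin 3 → ℝ) × GnoCoord L => q.2.2.1 := contDiff_fst.comp (contDiff_snd.comp contDiff_snd)
  have hx : ContDiff ℝ n fun q : (Fin 3 → ℝ) × GnoCoord L => su2Quat (quatToSU2 (gnoLetter ε.1.1 q.2.1.1)) := (contDiff_radialUnit_gnoLetter ε.1.1).comp hπx
  have hy : ContDiff ℝ n fun q : (Fin 3 → ℝ) × GnoCoord L => su2Quat (quatToSU2 (gnoLetter ε.1.2 q.2.1.2)) := (contDiff_radialUnit_gnoLetter ε.1.2).comp hπy
  have hz : ContDiff ℝ n fun q : (Fin 3 → ℝ) × GnoCoord L => su2Quat (quatToSU2 (gnoLetter ε.2.1 q.2.2.1)) := (contDiff_radialUnit_gnoLetter ε.2.1).comp hπz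
  have hAs : ContDiff ℝ n fun q : (Fin 3 → ℝ) × GnoCoord L => star (radialUnit (quatReImEquiv.symm (1, q.1) : ℍ)) := by
    have e : (fun q : (Fin 3 → ℝ) × GnoCoord L => star (radialUnit (quatReImEquiv.symm (1, q.1) : ℍ))) =
        fun q => radialUnit (quatReImEquiv.symm (1, -q.1) : ℍ) := funext fun q => by rw [Gnomonic.star_radialUnit, star_quatReImEquiv_symm_one]
    rw [e]; exact contDiff_radialUnit_hubCart.comp contDiff_fst.neg
  have hA1 : ∀ q : (Fin 3 → ℝ) × GnoCoord L, ‖radialUnit (quatReImEquiv.symm (1, q.1) : ℍ)‖ = 1 := fun q => norm_radialUnit (quatReImEquiv_symm_one_ne_zero q.1)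
  refine contDiff_chartDeficit_of_letters (X := (Fin 3 → ℝ) × GnoCoord L)
    (C := fun q => (cartPoint (quatReImEquiv.symm (1, q.1)) ε q.2).1) (U := fun q => (cartPoint (quatReImEquiv.symm (1, q.1)) ε q.2).2) z χ (fun μ => ?_) (fun i => ?_)
  · match μ with
    | ⟨0, _⟩ =>
      have e : ∀ q : (Fin 3 → ℝ) × GnoCoord L, su2Quat ((cartPoint (quatReImEquiv.symm (1, q.1)) ε q.2).1 ⟨0, by omega⟩) = su2Quat (quatToSU2 (gnoLetter ε.1.1 q.2.1.1)) :=
        fun q => rfl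
      simp only [e]; exact hx
    | ⟨1, _⟩ =>
      have e : ∀ q : (Fin 3 → ℝ) × GnoCoord L, su2Quat ((cartPoint (quatReImEquiv.symm (1, q.1)) ε q.2).1 ⟨1, by omega⟩) =
          star (radialUnit (quatReImEquiv.symm (1, q.1) : ℍ)) * su2Quat (quatToSU2 (gnoLetter ε.1.1 q.2.1.1)) * radialUnit (quatReImEquiv.symm (1, q.1) : ℍ) *
            su2Quat (quatToSU2 (gnoLetter ε.2.1 q.2.2.1)) := fun q => by
        show su2Quat (quatToSU2 (slaveP (radialUnit (quatReImEquiv.symm (1, q.1) : ℍ)) (gnoLetter ε.1.1 q.2.1.1) * gnoLetter ε.2.1 q.2.2.1)) = _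
        exact su2Quat_quatToSU2_slaveP_mul (hA1 q) (gnoLetter_ne_zero _ _) (gnoLetter_ne_zero _ _)
      simp only [e]
      exact ((hAs.mul hx).mul hA).mul hz
    | ⟨2, _⟩ =>
      have e : ∀ q : (Fin 3 → ℝ) × GnoCoord L, su2Quat ((cartPoint (quatReImEquiv.symm (1, q.1)) ε q.2).1 ⟨2, by omega⟩) = su2Quat (quatToSU2 (gnoLetter ε.1.2 q.2.1.2)) :=
        fun q => rfl
      simp only [e]; exact hy
    | ⟨3, _⟩ =>
      have e : ∀ q : (Fin 3 → ℝ) × GnoCoord L, su2Quat ((cartPoint (quatReImEquiv.symm (1, q.1)) ε q.2).1 ⟨3, by omega⟩) =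
          radialUnit (quatReImEquiv.symm (1, q.1) : ℍ) := fun q => by
        show su2Quat (quatToSU2 (radialUnit (quatReImEquiv.symm (1, q.1) : ℍ))) = _
        rw [su2Quat_quatToSU2_eq_radialUnit (radialUnit_ne_zero' (quatReImEquiv_symm_one_ne_zero q.1)), radialUnit_def, hA1 q, inv_one, one_smul]
      simp only [e]; exact hA
  · have e : ∀ q : (Fin 3 → ℝ) × GnoCoord L, su2Quat ((cartPoint (quatReImEquiv.symm (1, q.1)) ε q.2).2 i) = su2Quat (quatToSU2 (gnoLetter (ε.2.2 i) (q.2.2.2 i))) :=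
      fun q => rfl
    simp only [e]
    have hF : ContDiff ℝ n fun q : (Fin 3 → ℝ) × GnoCoord L => q.2.2.2 := contDiff_snd.comp (contDiff_snd.comp contDiff_snd)
    have hπ : ContDiff ℝ n fun q : (Fin 3 → ℝ) × GnoCoord L => q.2.2.2 i := (contDiff_apply ℝ (Fin 3 → ℝ) i).comp hF
    exact (contDiff_radialUnit_gnoLetter (ε.2.2 i)).comp hπ

end Summit.QuantumFields.YangMills.Theorems.SwapVirialDeficit.BlowUpRing

end
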